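import Literature.Barriers.Schanuel.NesterenkoModularScopeDerivatives
import Mathlib.NumberTheory.ModularForms.Derivative
import Mathlib.NumberTheory.ModularForms.QExpansion
import Mathlib.Analysis.Normed.Module.FiniteDimension
import HarnessLib

/-!
# Barrier (Schanuel) `NesterenkoModularScope`: calculus of `q`-series on the upper half-plane — proofs only

`Literature/Barriers/Schanuel/NesterenkoModularScopeQSeries.lean` — sibling proofs file of
`NesterenkoModularScope.lean` (barrier `NesterenkoModularScope := nesterenko1996_thm_1_1`,
LNM 1752 Ch. 3 Theorem 1.1). No new definitions; proofs only. First step towards discharging the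
named fact `ramanujan1916_system` (Ramanujan's differential system (2) for the `q`-series
`P, Q, R`, LNM 1752 Ch. 3 §1) from Mathlib's theory of level-one modular forms: the elementary
calculus of functions on `ℍ` given by a convergent `q`-series `f(τ) = ∑ c_m q^m`,
`q = e^{2πiτ}` (`Function.Periodic.qParam 1 τ`).

* `summable_norm_mul_pow_of_hasSum_qParam` — such a series converges absolutely on every
  smaller disc: `∑ ‖c_m‖ r^m < ∞` for `r < 1` (evaluate at `τ = it` with `e^{−2πt} = r`; in `ℂ`
  summable = absolutely summable);
* `hasSum_normalizedDeriv_of_hasSum_qParam` — **`D f = ∑ m c_m q^m`** for Mathlib's normalised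
  derivative `D = (2πi)⁻¹ d/dτ` (`Derivative.normalizedDerivOfComplex`), i.e. `D = q d/dq = θ`
  on `q`-expansions (termwise differentiation on the `q`-disc and the chain rule through
  `q = e^{2πiτ}`); consequences `mdifferentiable_of_hasSum_qParam`,
  `isBoundedAtImInfty_normalizedDeriv_of_hasSum_qParam` (`D f` is again bounded at `i∞`);
* `hasSum_mul_of_hasSum_qParam` — products are Cauchy products:
  `f g = ∑ (∑_{i+j=m} c_i d_j) q^m`.

## References

* [NesterenkoPhilippon2001] Yu. V. Nesterenko, P. Philippon (eds.), *Introduction to Algebraic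
  Independence Theory*, LNM 1752, Springer 2001, Ch. 3 §1 (the operator `D = z d/dz` on the
  `q`-series `P, Q, R`, (2)).
* J.-P. Serre, *A Course in Arithmetic*, Springer GTM 7, Ch. VII §4.1 (`θ = q d/dq = (2πi)⁻¹ d/dz`).
  [folklore]
-/

noncomputable section

open Complex Filter Topology Metric Finset
open UpperHalfPlane hiding I
open scoped Real Manifold

namespace Literature.Barriers.Schanuel

/-! ### Absolute convergence on smaller discs -/

/-- `q = e^{2πiτ}` as a plain exponential. [folklore] -/
theorem qParam_one_eq (w : ℂ) : Function.Periodic.qParam 1 w = cexp (2 * π * I * w) := by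
  simp [Function.Periodic.qParam]

/-- For `0 < r < 1` there is `τ ∈ ℍ` with `|q(τ)| = r` (`τ = it`, `t = −log r / 2π`). [folklore] -/
theorem exists_norm_qParam_eq {r : ℝ} (hr0 : 0 < r) (hr1 : r < 1) :
    ∃ τ : ℍ, ‖Function.Periodic.qParam 1 (τ : ℂ)‖ = r := by
  set t : ℝ := -Real.log r / (2 * π) with ht
  have hlog : Real.log r < 0 := Real.log_neg hr0 hr1
  have ht0 : 0 < t := by rw [ht]; exact div_pos (by linarith) Real.two_pi_pos
  refine ⟨⟨(t : ℂ) * I, by simpa using ht0⟩, ?_⟩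
  rw [Function.Periodic.norm_qParam]
  have him : ((⟨(t : ℂ) * I, by simpa using ht0⟩ : ℍ) : ℂ).im = t := by simp
  rw [him, div_one, ht, show -2 * π * (-Real.log r / (2 * π)) = Real.log r by field_simp,
    Real.exp_log hr0]

/-- **A `q`-series converging on `ℍ` converges absolutely on every smaller disc**: if
`f(τ) = ∑ c_m q(τ)^m` for all `τ ∈ ℍ` then `∑ ‖c_m‖ r^m < ∞` for `0 ≤ r < 1`. [folklore] -/
theorem summable_norm_mul_pow_of_hasSum_qParam {f : ℍ → ℂ} {c : ℕ → ℂ}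
    (hf : ∀ τ : ℍ, HasSum (fun m => c m * Function.Periodic.qParam 1 (τ : ℂ) ^ m) (f τ))
    (r : ℝ) (hr0 : 0 ≤ r) (hr1 : r < 1) : Summable fun m => ‖c m‖ * r ^ m := by
  rcases hr0.eq_or_lt with h | hr0'
  · subst h
    refine summable_of_ne_finset_zero (s := {0}) fun n hn => ?_
    rw [Finset.mem_singleton] at hn
    simp [zero_pow hn]
  · obtain ⟨τ, hτ⟩ := exists_norm_qParam_eq hr0' hr1
    have hs : Summable fun m => c m * Function.Periodic.qParam 1 (τ : ℂ) ^ m := (hf τ).summable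
    have hn := (summable_norm_iff (E := ℂ)).mpr hs
    refine hn.congr fun m => ?_
    rw [norm_mul, norm_pow, hτ]

/-- If `∑ ‖c_m‖ r^m < ∞` for all `r < 1` then also `∑ m ‖c_m‖ r^m < ∞` for all `r < 1`.
[folklore] -/
theorem summable_mul_norm_mul_pow {c : ℕ → ℂ}
    (hc : ∀ r : ℝ, 0 ≤ r → r < 1 → Summable fun m => ‖c m‖ * r ^ m)
    (r : ℝ) (hr0 : 0 ≤ r) (hr1 : r < 1) : Summable fun m : ℕ => (m : ℝ) * ‖c m‖ * r ^ m := by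
  set r' : ℝ := (r + 1) / 2 with hr'
  have hr'0 : 0 < r' := by rw [hr']; linarith
  have hr'1 : r' < 1 := by rw [hr']; linarith
  have hrr' : r < r' := by rw [hr']; linarith
  have hs := hc r' hr'0.le hr'1
  set B : ℝ := ∑' m, ‖c m‖ * r' ^ m with hB
  have hle : ∀ m, ‖c m‖ * r' ^ m ≤ B := fun m =>
    hs.le_tsum m fun j _ => mul_nonneg (norm_nonneg _) (pow_nonneg hr'0.le _)
  have hx : ‖r / r'‖ < 1 := by
    rw [Real.norm_eq_abs, abs_of_nonneg (by positivity), div_lt_one hr'0]; exact hrr'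
  have hgeom : Summable fun m : ℕ => B * ((m : ℝ) ^ 1 * (r / r') ^ m) :=
    (summable_pow_mul_geometric_of_norm_lt_one 1 hx).mul_left B
  refine Summable.of_nonneg_of_le (fun m => by positivity) (fun m => ?_) hgeom
  have hsplit : r ^ m = (r / r') ^ m * r' ^ m := by
    rw [div_pow, div_mul_cancel₀ _ (pow_ne_zero m hr'0.ne')]
  calc (m : ℝ) * ‖c m‖ * r ^ m = (‖c m‖ * r' ^ m) * ((m : ℝ) ^ 1 * (r / r') ^ m) := by
        rw [hsplit]; ring
    _ ≤ B * ((m : ℝ) ^ 1 * (r / r') ^ m) :=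
        mul_le_mul_of_nonneg_right (hle m) (by positivity)

/-! ### `D = θ` on `q`-series -/

/-- Near `τ ∈ ℍ` the pull-back `f ∘ ofComplex` is the composite of the disc function
`F(q) = ∑ c_m q^m` with `q = e^{2πiw}`. [folklore] -/
theorem comp_ofComplex_eventuallyEq {f : ℍ → ℂ} {c : ℕ → ℂ}
    (hf : ∀ τ : ℍ, HasSum (fun m => c m * Function.Periodic.qParam 1 (τ : ℂ) ^ m) (f τ))
    (τ : ℍ) :
    (f ∘ ofComplex) =ᶠ[𝓝 (τ : ℂ)] fun w => ∑' m : ℕ, c m * cexp (2 * π * I * w) ^ m := by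
  filter_upwards [isOpen_upperHalfPlaneSet.mem_nhds τ.im_pos] with w hw
  have hw' : 0 < w.im := hw
  rw [Function.comp_apply, ofComplex_apply_of_im_pos hw']
  have h := hf ⟨w, hw'⟩
  simp only [qParam_one_eq] at h
  exact h.tsum_eq.symm

/-- **`D f = θ f` on `q`-series**: if `f(τ) = ∑ c_m q^m` on `ℍ` then
`D f(τ) = ∑ m c_m q^m`, `D = (2πi)⁻¹ d/dτ`. [folklore] -/
theorem hasSum_normalizedDeriv_of_hasSum_qParam {f : ℍ → ℂ} {c : ℕ → ℂ}
    (hf : ∀ τ : ℍ, HasSum (fun m => c m * Function.Periodic.qParam 1 (τ : ℂ) ^ m) (f τ))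
    (τ : ℍ) :
    HasSum (fun m : ℕ => (m : ℂ) * c m * Function.Periodic.qParam 1 (τ : ℂ) ^ m)
      (Derivative.normalizedDerivOfComplex f τ) := by
  have hc := summable_norm_mul_pow_of_hasSum_qParam hf
  set q : ℂ := Function.Periodic.qParam 1 (τ : ℂ) with hq
  have hq1 : ‖q‖ < 1 := Function.Periodic.norm_qParam_lt_one one_pos (by simpa using τ.im_pos)
  -- the disc function and its derivative
  have hF : HasDerivAt (fun w => ∑' m : ℕ, c m * w ^ m)
      (∑' m : ℕ, (m : ℂ) * c m * q ^ (m - 1)) q := by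
    have h := hasDerivAt_tsum_termwise c hc 0 hq1
    simp only [Finset.range_zero, Finset.prod_empty, one_mul, Nat.sub_zero, zero_add,
      Finset.range_one, Finset.prod_singleton, Nat.cast_zero, sub_zero] at h
    exact h
  -- the chain rule through `q = e^{2πiw}`
  have hexp : HasDerivAt (fun w : ℂ => cexp (2 * π * I * w)) (q * (2 * π * I)) (τ : ℂ) := by
    have h := ((hasDerivAt_id (τ : ℂ)).const_mul (2 * π * I)).cexp
    simp only [mul_one, id_eq] at h
    rw [hq, qParam_one_eq]
    exact h
  have hcomp : HasDerivAt (fun w : ℂ => ∑' m : ℕ, c m * cexp (2 * π * I * w) ^ m)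
      ((∑' m : ℕ, (m : ℂ) * c m * q ^ (m - 1)) * (q * (2 * π * I))) (τ : ℂ) := by
    have hq' : cexp (2 * π * I * (τ : ℂ)) = q := by rw [hq, qParam_one_eq]
    have hF' : HasDerivAt (fun w => ∑' m : ℕ, c m * w ^ m)
        (∑' m : ℕ, (m : ℂ) * c m * q ^ (m - 1)) (cexp (2 * π * I * (τ : ℂ))) := by
      rw [hq']; exact hF
    exact hF'.comp (τ : ℂ) hexp
  have hderiv : deriv (f ∘ ofComplex) (τ : ℂ) =
      (∑' m : ℕ, (m : ℂ) * c m * q ^ (m - 1)) * (q * (2 * π * I)) := by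
    rw [(comp_ofComplex_eventuallyEq hf τ).deriv_eq]
    exact hcomp.deriv
  have hD : Derivative.normalizedDerivOfComplex f τ = ∑' m : ℕ, (m : ℂ) * c m * q ^ m := by
    rw [Derivative.normalizedDerivOfComplex, hderiv]
    have h2pi : (2 * π * I : ℂ) ≠ 0 := two_pi_I_ne_zero
    calc (2 * π * I)⁻¹ * ((∑' m : ℕ, (m : ℂ) * c m * q ^ (m - 1)) * (q * (2 * π * I)))
        = q * ∑' m : ℕ, (m : ℂ) * c m * q ^ (m - 1) := by field_simp
      _ = ∑' m : ℕ, q * ((m : ℂ) * c m * q ^ (m - 1)) := tsum_mul_left.symm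
      _ = ∑' m : ℕ, (m : ℂ) * c m * q ^ m := by
          refine tsum_congr fun m => ?_
          rcases m with _ | m
          · simp
          · rw [Nat.add_sub_cancel, pow_succ]; ring
  -- summability of `∑ m c_m q^m`
  have hs : Summable fun m : ℕ => (m : ℂ) * c m * q ^ m := by
    refine .of_norm ?_
    refine (summable_mul_norm_mul_pow hc ‖q‖ (norm_nonneg q) hq1).congr fun m => ?_
    rw [norm_mul, norm_mul, norm_pow, Complex.norm_natCast]
  rw [hD]
  exact hs.hasSum

/-- A function on `ℍ` given by a convergent `q`-series is holomorphic. [folklore] -/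
theorem mdifferentiable_of_hasSum_qParam {f : ℍ → ℂ} {c : ℕ → ℂ}
    (hf : ∀ τ : ℍ, HasSum (fun m => c m * Function.Periodic.qParam 1 (τ : ℂ) ^ m) (f τ)) :
    MDifferentiable 𝓘(ℂ) 𝓘(ℂ) f := by
  have hc := summable_norm_mul_pow_of_hasSum_qParam hf
  intro τ
  rw [UpperHalfPlane.mdifferentiableAt_iff]
  have hq1 : ‖cexp (2 * π * I * (τ : ℂ))‖ < 1 := by
    rw [← qParam_one_eq]
    exact Function.Periodic.norm_qParam_lt_one one_pos (by simpa using τ.im_pos)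
  have hF : DifferentiableAt ℂ (fun w => ∑' m : ℕ, c m * w ^ m) (cexp (2 * π * I * (τ : ℂ))) := by
    have h := hasDerivAt_tsum_termwise c hc 0 hq1
    simp only [Finset.range_zero, Finset.prod_empty, one_mul, Nat.sub_zero] at h
    exact h.differentiableAt
  have hexp : DifferentiableAt ℂ (fun w : ℂ => cexp (2 * π * I * w)) (τ : ℂ) :=
    ((differentiableAt_id).const_mul _).cexp
  have hc' : DifferentiableAt ℂ (fun w : ℂ => ∑' m : ℕ, c m * cexp (2 * π * I * w) ^ m) (τ : ℂ) :=
    DifferentiableAt.comp (τ : ℂ) (g := fun w : ℂ => ∑' m : ℕ, c m * w ^ m) hF hexp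
  exact hc'.congr_of_eventuallyEq (comp_ofComplex_eventuallyEq hf τ)

/-- **`D f` is bounded at `i∞`** (indeed `D f = ∑ m c_m q^m` is again a convergent `q`-series).
[folklore] -/
theorem isBoundedAtImInfty_normalizedDeriv_of_hasSum_qParam {f : ℍ → ℂ} {c : ℕ → ℂ}
    (hf : ∀ τ : ℍ, HasSum (fun m => c m * Function.Periodic.qParam 1 (τ : ℂ) ^ m) (f τ)) :
    IsBoundedAtImInfty (Derivative.normalizedDerivOfComplex f) :=
  isBoundedAtImInfty_of_hasSum_qExpansion (c := fun m : ℕ => (m : ℂ) * c m) one_pos fun τ => by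
    simpa only [smul_eq_mul] using hasSum_normalizedDeriv_of_hasSum_qParam hf τ

/-- A function on `ℍ` given by a convergent `q`-series is bounded at `i∞` (Mathlib's
`isBoundedAtImInfty_of_hasSum_qExpansion`, restated with `*`). [folklore] -/
theorem isBoundedAtImInfty_of_hasSum_qParam {f : ℍ → ℂ} {c : ℕ → ℂ}
    (hf : ∀ τ : ℍ, HasSum (fun m => c m * Function.Periodic.qParam 1 (τ : ℂ) ^ m) (f τ)) :
    IsBoundedAtImInfty f :=
  isBoundedAtImInfty_of_hasSum_qExpansion (c := c) one_pos fun τ => by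
    simpa only [smul_eq_mul] using hf τ

/-! ### Products -/

/-- **Products of `q`-series are Cauchy products**: if `f = ∑ c_m q^m` and `g = ∑ d_m q^m` on
`ℍ` then `f g = ∑_m (∑_{i+j=m} c_i d_j) q^m`. [folklore] -/
theorem hasSum_mul_of_hasSum_qParam {f g : ℍ → ℂ} {c d : ℕ → ℂ}
    (hf : ∀ τ : ℍ, HasSum (fun m => c m * Function.Periodic.qParam 1 (τ : ℂ) ^ m) (f τ))
    (hg : ∀ τ : ℍ, HasSum (fun m => d m * Function.Periodic.qParam 1 (τ : ℂ) ^ m) (g τ))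
    (τ : ℍ) :
    HasSum (fun m => (∑ p ∈ antidiagonal m, c p.1 * d p.2) *
      Function.Periodic.qParam 1 (τ : ℂ) ^ m) (f τ * g τ) := by
  set q : ℂ := Function.Periodic.qParam 1 (τ : ℂ) with hq
  have hq1 : ‖q‖ < 1 := Function.Periodic.norm_qParam_lt_one one_pos (by simpa using τ.im_pos)
  have hcn : Summable fun m => ‖c m * q ^ m‖ := by
    refine (summable_norm_mul_pow_of_hasSum_qParam hf ‖q‖ (norm_nonneg q) hq1).congr fun m => ?_
    rw [norm_mul, norm_pow]
  have hdn : Summable fun m => ‖d m * q ^ m‖ := by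
    refine (summable_norm_mul_pow_of_hasSum_qParam hg ‖q‖ (norm_nonneg q) hq1).congr fun m => ?_
    rw [norm_mul, norm_pow]
  have hprod : ∀ n, (∑ kl ∈ antidiagonal n, c kl.1 * q ^ kl.1 * (d kl.2 * q ^ kl.2)) =
      (∑ p ∈ antidiagonal n, c p.1 * d p.2) * q ^ n := by
    intro n
    rw [Finset.sum_mul]
    refine Finset.sum_congr rfl fun kl hkl => ?_
    rw [HasAntidiagonal.mem_antidiagonal] at hkl
    rw [← hkl, pow_add]; ring
  have hs := summable_norm_sum_mul_antidiagonal_of_summable_norm hcn hdn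
  have hsum : Summable fun n => (∑ p ∈ antidiagonal n, c p.1 * d p.2) * q ^ n := by
    simpa only [hprod] using hs.of_norm
  have htsum := tsum_mul_tsum_eq_tsum_sum_antidiagonal_of_summable_norm hcn hdn
  simp only [hprod] at htsum
  rw [(hf τ).tsum_eq, (hg τ).tsum_eq] at htsum
  rw [htsum]
  exact hsum.hasSum

/-- Scalar multiples of `q`-series. [folklore] -/
theorem hasSum_const_mul_of_hasSum_qParam {f : ℍ → ℂ} {c : ℕ → ℂ} (a : ℂ)
    (hf : ∀ τ : ℍ, HasSum (fun m => c m * Function.Periodic.qParam 1 (τ : ℂ) ^ m) (f τ))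
    (τ : ℍ) :
    HasSum (fun m => (a * c m) * Function.Periodic.qParam 1 (τ : ℂ) ^ m) (a * f τ) := by
  simpa only [mul_assoc] using (hf τ).mul_left a

/-- Differences of `q`-series. [folklore] -/
theorem hasSum_sub_of_hasSum_qParam {f g : ℍ → ℂ} {c d : ℕ → ℂ}
    (hf : ∀ τ : ℍ, HasSum (fun m => c m * Function.Periodic.qParam 1 (τ : ℂ) ^ m) (f τ))
    (hg : ∀ τ : ℍ, HasSum (fun m => d m * Function.Periodic.qParam 1 (τ : ℂ) ^ m) (g τ))
    (τ : ℍ) :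
    HasSum (fun m => (c m - d m) * Function.Periodic.qParam 1 (τ : ℂ) ^ m) (f τ - g τ) := by
  simpa only [sub_mul] using (hf τ).sub (hg τ)

end Literature.Barriers.Schanuel

end
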